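import Summits.Ventures.Crystal3D.Theorems.StickyWulffConstantCoaxialWallLawSeamThreePayer
import HarnessLib

/-!
# The SEALED-BALL row: true deficiency at core balls no outside ball touches; the input of record to build `UnionCoreSealedCapWin₃ s` (cf-p1 (cclxx))
# (crux `CoaxialWallLaw`, stmt-Ventures-19481; line `WallLedgerF`, skeleton 'CoaxialWallLawCertificates', T5b after the refutation of the v8.2 input `stub_unionCoreCap`)

HONEST FRAMING. Venture `Summits/Ventures/Crystal3D` (cell `crystal3d-full`); sequel of '…SeamThreePayer'.  19481-p1 g19's CERTPROBE (kit j334826/j334870) measured the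
floor + star-row functional on the cell's anchor windows: it fails `2√6` on the decahedral axis with two vacancies (`1381/280 = 4.93`, true `Σ_A = 4.3705`) and on the
icosahedral model (`8.97`), because every `capTable₃` row certifies at most ONE unit of gain per ball (M1) and balls with non-lattice dozens get none (M2), although
on those windows the core EXHAUSTS the window and the true deficiency of every core ball is visible (M3).  The repair of record (R1, 19481-p1; adopted cf-p1 (cclxviii)/
(cclxx)) is the SEALED-BALL ROW: a core ball `y` that NO ball of the configuration outside the core touches has junk `0`, hence certified gain = its full core
deficiency `12 − deg_D y`.  The row sees the configuration (not the core alone): the certificate owner takes, per core, the worst unsealing the geometry allows.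
* `IsSealed X D y`, `sealedGain X D y` (= `12 − deg_D y` if sealed, else the `capTable₃` gain), `sealedGain_le_deficiency` (two lines of soundness + the E1 table);
* `sealedPool`, `sealedPool₃` (payer term + sealed gains; floor `3` at loaded `b ≠ z`, `1` at `z`), `sealedSummand₃`; `sealedPool_le_pooledDef`, `sealedPool₃_le_pooledDef (h3)`,
  `payerPool_le_sealedPool` / `sealedSummand₃_le_payerSummand₃` (the sealed functional is below the floor-3 star functional);
* **`localSummandA_le_sealedSummand₃_unionCoreStar (hE1) (h3 : ThreePayer)`**;
* **`UnionCoreSealedCapWin₃ s`** (NAMED INPUT — the certificate of record to build: payer `0`, `Y ⊆ B̄(0, 3)`, standard systems, star-closed union core, sealed row,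
  floor 3), `unionCoreSealedCapWin₃_of_win₃`, **`localSummandA_le_of_threePayer_of_sealedWin₃ (hE1) (h3) (h)`** (every frame, every payer),
  **`t5b_of_threePayer_of_sealedWin₃ : P5Exhaustion → ThreePayer → UnionCoreSealedCapWin₃ (2 * Real.sqrt 6) → CoherentSeamSmall (2√6) 3 ∧ IncoherentSeamSmall (2√6) 3`**.
NUMBERS OF RECORD (19481-p1 j334870, sealed variant with floor 1): deca + 2 vac `4.3705`, deca axis `2.333`, icosa `2.079`, Σ9 junction `1.143`; thin pieces (this file's
floor 3 under `ThreePayer`): `≤ 1/3` per loaded ball.  WHAT THIS IS NOT: neither `ThreePayer` nor the certificate is proved; F-C1 not moved.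
-/

noncomputable section

namespace Summit.Ventures.Crystal3D.Theorems

namespace TailResidue

open Summit.Ventures.Crystal3D Finset
open scoped InnerProductSpace

/-! ### Sealed balls and the sealed gain -/

/-- **SEALED core ball**: no ball of the configuration outside the core touches `y`. -/
def IsSealed (X D : Finset (EuclideanSpace ℝ (Fin 3))) (y : EuclideanSpace ℝ (Fin 3)) : Prop := ∀ x ∈ X, x ∉ D → dist y x ≠ 1

open scoped Classical in
/-- **THE SEALED GAIN** of the core ball `y`: its full core deficiency `12 − deg_D y` if it is sealed, the `capTable₃` certified gain otherwise. -/
def sealedGain (X D : Finset (EuclideanSpace ℝ (Fin 3))) (y : EuclideanSpace ℝ (Fin 3)) : ℝ :=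
  if IsSealed X D y then max 0 ((12 : ℝ) - ((D.filter fun q => dist y q = 1).card : ℝ)) else capGain capTable₃ D y

/-- Sealed gains are nonnegative. -/
theorem sealedGain_nonneg (X D : Finset (EuclideanSpace ℝ (Fin 3))) (y : EuclideanSpace ℝ (Fin 3)) : 0 ≤ sealedGain X D y := by
  unfold sealedGain
  split_ifs
  · exact le_max_left _ _
  · exact capGain_nonneg D y

/-- The sealed gain is at least the `capTable₃` gain. -/
theorem capGain_le_sealedGain (X D : Finset (EuclideanSpace ℝ (Fin 3))) (y : EuclideanSpace ℝ (Fin 3)) : capGain capTable₃ D y ≤ sealedGain X D y := by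
  unfold sealedGain
  split_ifs
  · unfold capGain
    exact max_le_max le_rfl (by linarith [(Nat.cast_nonneg (capTable₃ D y) : (0 : ℝ) ≤ _)])
  · exact le_rfl

open scoped Classical in
/-- A sealed core ball has no junk contact. -/
theorem junk_eq_zero_of_isSealed {X D : Finset (EuclideanSpace ℝ (Fin 3))} {y : EuclideanSpace ℝ (Fin 3)} (h : IsSealed X D y) :
    ((X \ D).filter fun x => dist y x = 1).card = 0 := by
  rw [card_eq_zero, eq_empty_iff_forall_notMem]
  intro x hx
  obtain ⟨hx, hd⟩ := mem_filter.1 hx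
  exact h x (mem_sdiff.1 hx).1 (mem_sdiff.1 hx).2 hd

open scoped Classical in
/-- **Soundness of the sealed row**: the sealed gain of a core ball within `2` of the payer never exceeds its true deficiency (sealed ⇒ junk `0`; otherwise the E1 table). -/
theorem sealedGain_le_deficiency {X D : Finset (EuclideanSpace ℝ (Fin 3))} (hX : ∀ p ∈ X, ∀ q ∈ X, p ≠ q → 1 ≤ dist p q) (hDX : D ⊆ X) {z : EuclideanSpace ℝ (Fin 3)}
    (hjunk : ∀ y ∈ D, dist z y ≤ 2 → ((X \ D).filter fun x => dist y x = 1).card ≤ capTable₃ D y) {y : EuclideanSpace ℝ (Fin 3)} (hy : y ∈ D) (hzy : dist z y ≤ 2) :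
    sealedGain X D y ≤ (12 : ℝ) - ((X.filter fun q => dist y q = 1).card : ℝ) := by
  unfold sealedGain
  split_ifs with hs
  · have hsplit := card_contacts_eq_junk_add_core hDX y
    rw [junk_eq_zero_of_isSealed hs, zero_add] at hsplit
    have h12 : ((D.filter fun q => dist y q = 1).card : ℝ) ≤ 12 := by
      rw [← hsplit]; exact_mod_cast card_filter_dist_eq_one_le_twelve X hX y
    rw [hsplit]
    exact max_le (by linarith) le_rfl
  · exact capGain_le_deficiency hX hDX hjunk hy hzy

/-! ### Sealed pools and the functional -/

open scoped Classical in
/-- **THE SEALED POOL** of the core ball `b` at the payer `z`: the payer's unit (or its sealed gain if larger) plus the sealed gains of the other core balls within `1`. -/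
def sealedPool (X D : Finset (EuclideanSpace ℝ (Fin 3))) (z b : EuclideanSpace ℝ (Fin 3)) : ℝ :=
  (if z ∈ D then max 1 (sealedGain X D z) else 1) + ∑ y ∈ (D.erase z).filter (fun y => dist b y ≤ 1), sealedGain X D y

open scoped Classical in
/-- **THE THREE-PAYER-FLOORED SEALED POOL**: `sealedPool` at the payer, `max 3 sealedPool` elsewhere. -/
def sealedPool₃ (X D : Finset (EuclideanSpace ℝ (Fin 3))) (z b : EuclideanSpace ℝ (Fin 3)) : ℝ :=
  if b = z then sealedPool X D z b else max 3 (sealedPool X D z b)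

open scoped Classical in
/-- **THE SEALED FLOOR-3 CAPPED (A)-SUMMAND** of the core `D` of the configuration `X` at the payer `z`. -/
def sealedSummand₃ (v : WordVersion) (S₁ S₂ : PlateSystem) (X D : Finset (EuclideanSpace ℝ (Fin 3))) (z : EuclideanSpace ℝ (Fin 3)) : ℝ :=
  ∑ b ∈ D.filter (fun b => dist z b ≤ 1 ∧ 0 < endMultA D v S₁ S₂ b), (endMultA D v S₁ S₂ b : ℝ) / sealedPool₃ X D z b

open scoped Classical in
/-- The floor-1 star pool is at most the sealed pool. -/
theorem payerPool_le_sealedPool (X D : Finset (EuclideanSpace ℝ (Fin 3))) (z b : EuclideanSpace ℝ (Fin 3)) : payerPool capTable₃ D z b ≤ sealedPool X D z b := by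
  unfold payerPool sealedPool
  refine add_le_add ?_ (sum_le_sum fun y _ => capGain_le_sealedGain X D y)
  split_ifs
  · exact max_le_max le_rfl (capGain_le_sealedGain X D z)
  · exact le_rfl

open scoped Classical in
/-- The sealed pool is at least `1`. -/
theorem one_le_sealedPool (X D : Finset (EuclideanSpace ℝ (Fin 3))) (z b : EuclideanSpace ℝ (Fin 3)) : 1 ≤ sealedPool X D z b :=
  (one_le_payerPool D z b).trans (payerPool_le_sealedPool X D z b)

open scoped Classical in
/-- The floor-3 star pool is at most the floor-3 sealed pool. -/
theorem payerPool₃_le_sealedPool₃ (X D : Finset (EuclideanSpace ℝ (Fin 3))) (z b : EuclideanSpace ℝ (Fin 3)) : payerPool₃ capTable₃ D z b ≤ sealedPool₃ X D z b := by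
  unfold payerPool₃ sealedPool₃
  split_ifs
  · exact payerPool_le_sealedPool X D z b
  · exact max_le_max le_rfl (payerPool_le_sealedPool X D z b)

/-- The floor-3 sealed pool is positive. -/
theorem sealedPool₃_pos (X D : Finset (EuclideanSpace ℝ (Fin 3))) (z b : EuclideanSpace ℝ (Fin 3)) : 0 < sealedPool₃ X D z b :=
  lt_of_lt_of_le (payerPool₃_pos D z b) (payerPool₃_le_sealedPool₃ X D z b)

open scoped Classical in
/-- **The sealed functional is at most the floor-3 star functional** (every certificate bound for `payerSummand₃` transfers). -/
theorem sealedSummand₃_le_payerSummand₃ (v : WordVersion) (S₁ S₂ : PlateSystem) (X D : Finset (EuclideanSpace ℝ (Fin 3))) (z : EuclideanSpace ℝ (Fin 3)) :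
    sealedSummand₃ v S₁ S₂ X D z ≤ payerSummand₃ capTable₃ v S₁ S₂ D z := by
  unfold sealedSummand₃ payerSummand₃
  exact sum_le_sum fun b _ => div_le_div_of_nonneg_left (Nat.cast_nonneg _) (payerPool₃_pos D z b) (payerPool₃_le_sealedPool₃ X D z b)

open scoped Classical in
/-- **The sealed pool never exceeds the true pool.** -/
theorem sealedPool_le_pooledDef {X D : Finset (EuclideanSpace ℝ (Fin 3))} (hX : ∀ p ∈ X, ∀ q ∈ X, p ≠ q → 1 ≤ dist p q) (hDX : D ⊆ X) {z : EuclideanSpace ℝ (Fin 3)}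
    (hjunk : ∀ y ∈ D, dist z y ≤ 2 → ((X \ D).filter fun x => dist y x = 1).card ≤ capTable₃ D y) (hz : z ∈ X) (hdeg : (X.filter fun q => dist z q = 1).card ≤ 11)
    {b : EuclideanSpace ℝ (Fin 3)} (hzb : dist z b ≤ 1) : sealedPool X D z b ≤ pooledDef X b := by
  rw [pooledDef_eq_sum hX b]
  set T := (D.erase z).filter (fun y => dist b y ≤ 1) with hT
  have hzmem : z ∈ X.filter (fun x => dist b x ≤ 1) := mem_filter.2 ⟨hz, by rwa [dist_comm]⟩
  have hTsub : T ⊆ X.filter (fun x => dist b x ≤ 1) := fun y hy => mem_filter.2 ⟨hDX (mem_of_mem_erase (mem_filter.1 hy).1), (mem_filter.1 hy).2⟩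
  have hzT : z ∉ T := fun h => notMem_erase z D (mem_filter.1 h).1
  have hins : insert z T ⊆ X.filter (fun x => dist b x ≤ 1) := insert_subset hzmem hTsub
  have hzterm : (if z ∈ D then max 1 (sealedGain X D z) else 1) ≤ (12 : ℝ) - ((X.filter fun q => dist z q = 1).card : ℝ) := by
    have h1 : (1 : ℝ) ≤ (12 : ℝ) - ((X.filter fun q => dist z q = 1).card : ℝ) := by
      have : ((X.filter fun q => dist z q = 1).card : ℝ) ≤ 11 := by exact_mod_cast hdeg
      linarith
    split_ifs with hzD
    · exact max_le h1 (sealedGain_le_deficiency hX hDX hjunk hzD (by simp))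
    · exact h1
  have hterms : ∀ y ∈ T, sealedGain X D y ≤ (12 : ℝ) - ((X.filter fun q => dist y q = 1).card : ℝ) := by
    intro y hy
    obtain ⟨hy, hby⟩ := mem_filter.1 hy
    exact sealedGain_le_deficiency hX hDX hjunk (mem_of_mem_erase hy) (by linarith [dist_triangle z b y])
  have hnonneg : ∀ x ∈ X.filter (fun x => dist b x ≤ 1), x ∉ insert z T → (0 : ℝ) ≤ (12 : ℝ) - ((X.filter fun q => dist x q = 1).card : ℝ) := by
    intro x _ _
    have : ((X.filter fun q => dist x q = 1).card : ℝ) ≤ 12 := by exact_mod_cast card_filter_dist_eq_one_le_twelve X hX x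
    linarith
  calc sealedPool X D z b
      = (if z ∈ D then max 1 (sealedGain X D z) else 1) + ∑ y ∈ T, sealedGain X D y := rfl
    _ ≤ ((12 : ℝ) - ((X.filter fun q => dist z q = 1).card : ℝ)) + ∑ y ∈ T, ((12 : ℝ) - ((X.filter fun q => dist y q = 1).card : ℝ)) :=
        add_le_add hzterm (sum_le_sum hterms)
    _ = ∑ x ∈ insert z T, ((12 : ℝ) - ((X.filter fun q => dist x q = 1).card : ℝ)) := by rw [sum_insert hzT]
    _ ≤ ∑ x ∈ X.filter (fun x => dist b x ≤ 1), ((12 : ℝ) - ((X.filter fun q => dist x q = 1).card : ℝ)) :=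
        sum_le_sum_of_subset_of_nonneg hins hnonneg

open scoped Classical in
/-- **Under `ThreePayer`, the floor-3 sealed pool never exceeds the true pool** at an (A)-end ball within `1` of the payer. -/
theorem sealedPool₃_le_pooledDef (h3 : ThreePayer) {X D : Finset (EuclideanSpace ℝ (Fin 3))} (hX : ∀ p ∈ X, ∀ q ∈ X, p ≠ q → 1 ≤ dist p q) (hDX : D ⊆ X)
    {z : EuclideanSpace ℝ (Fin 3)} (hjunk : ∀ y ∈ D, dist z y ≤ 2 → ((X \ D).filter fun x => dist y x = 1).card ≤ capTable₃ D y) (hz : z ∈ X)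
    (hdeg : (X.filter fun q => dist z q = 1).card ≤ 11) {v : WordVersion} {S₁ S₂ : PlateSystem} (h₁ : S₁.RT ⊆ fccSlots) (h₂ : S₂.RT ⊆ fccSlots)
    {b q : EuclideanSpace ℝ (Fin 3)} (hzb : dist z b ≤ 1) (hp : IsEndPairA X v S₁ S₂ b q) : sealedPool₃ X D z b ≤ pooledDef X b := by
  unfold sealedPool₃
  split_ifs with hbz
  · exact sealedPool_le_pooledDef hX hDX hjunk hz hdeg hzb
  · exact max_le (h3 X hX z hz hdeg v S₁ S₂ h₁ h₂ b q hzb hbz hp) (sealedPool_le_pooledDef hX hDX hjunk hz hdeg hzb)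

/-! ### The comparison -/

open scoped Classical in
/-- **`Σ_A(Y, z) ≤ sealedSummand₃ Y (unionCoreStar Y z) z`** at every payer of degree `≤ 11`, under E1 and `ThreePayer`. -/
theorem localSummandA_le_sealedSummand₃_unionCoreStar (hE1 : P5Exhaustion) (h3 : ThreePayer) {Y : Finset (EuclideanSpace ℝ (Fin 3))}
    (hY : ∀ p ∈ Y, ∀ p' ∈ Y, p ≠ p' → 1 ≤ dist p p') {v : WordVersion} {S₁ S₂ : PlateSystem} (h₁ : S₁.RT ⊆ fccSlots) (h₂ : S₂.RT ⊆ fccSlots)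
    {z : EuclideanSpace ℝ (Fin 3)} (hz : z ∈ Y) (hdeg : (Y.filter fun q => dist z q = 1).card ≤ 11) :
    localSummandA v S₁ S₂ Y z ≤ sealedSummand₃ v S₁ S₂ Y (unionCoreStar Y z v S₁ S₂) z := by
  set D := unionCoreStar Y z v S₁ S₂ with hDdef
  have hD : IsStarClosed Y z D := isStarClosed_unionCoreStar
  have hDY : D ⊆ Y := hD.subset
  have hjunk : ∀ y ∈ D, dist z y ≤ 2 → ((Y \ D).filter fun x => dist y x = 1).card ≤ capTable₃ D y :=
    fun y hy hzy => junkCapBoundStar_capTable₃ hE1 Y hY z D hD y hy hzy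
  unfold localSummandA sealedSummand₃
  have hsub : Y.filter (fun b => dist z b ≤ 1 ∧ 0 < endMultA Y v S₁ S₂ b) ⊆ D.filter (fun b => dist z b ≤ 1 ∧ 0 < endMultA D v S₁ S₂ b) := by
    intro b hb
    obtain ⟨-, hzb, he⟩ := mem_filter.1 hb
    have hle : endMultA Y v S₁ S₂ b ≤ endMultA D v S₁ S₂ b := endMultA_le_unionCoreStar hY h₁ h₂ hzb
    obtain ⟨q, hq⟩ := card_pos.1 he
    have hpD := isEndPairA_unionCoreStar hY h₁ h₂ hzb (mem_filter.1 hq).2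
    exact mem_filter.2 ⟨hpD.2.1, hzb, lt_of_lt_of_le he hle⟩
  calc ∑ b ∈ Y.filter (fun b => dist z b ≤ 1 ∧ 0 < endMultA Y v S₁ S₂ b), (endMultA Y v S₁ S₂ b : ℝ) / pooledDef Y b
      ≤ ∑ b ∈ Y.filter (fun b => dist z b ≤ 1 ∧ 0 < endMultA Y v S₁ S₂ b), (endMultA D v S₁ S₂ b : ℝ) / sealedPool₃ Y D z b := by
        refine sum_le_sum fun b hb => ?_
        obtain ⟨-, hzb, he⟩ := mem_filter.1 hb
        obtain ⟨q, hq⟩ := card_pos.1 he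
        exact div_le_div₀ (Nat.cast_nonneg _) (Nat.cast_le.2 (endMultA_le_unionCoreStar hY h₁ h₂ hzb)) (sealedPool₃_pos Y D z b)
          (sealedPool₃_le_pooledDef h3 hY hDY hjunk hz hdeg h₁ h₂ hzb (mem_filter.1 hq).2)
    _ ≤ ∑ b ∈ D.filter (fun b => dist z b ≤ 1 ∧ 0 < endMultA D v S₁ S₂ b), (endMultA D v S₁ S₂ b : ℝ) / sealedPool₃ Y D z b :=
        sum_le_sum_of_subset_of_nonneg hsub fun b _ _ => div_nonneg (Nat.cast_nonneg _) (sealedPool₃_pos Y D z b).le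

/-! ### The certificate of record to build and the by-name consequences -/

open scoped Classical in
/-- **STAR-CLOSED UNION-CORE CERTIFICATE WITH THE SEALED ROW, FLOOR 3, WINDOW FORM (named input — the lane-F T5b certificate of record to build, cf-p1 (cclxx))**:
for every finite `1`-separated `Y ⊆ B̄(0, 3)` containing the payer `0` with degree `≤ 11`, the sealed floor-3 capped (A)-summand (`v2`, standard systems) of the
star-closed union core of `0` is `≤ s`.  The functional depends on the window `Y` and its core; the certifier takes the worst unsealing per core. -/
def UnionCoreSealedCapWin₃ (s : ℝ) : Prop :=
  ∀ Y : Finset (EuclideanSpace ℝ (Fin 3)), (∀ y ∈ Y, dist (0 : EuclideanSpace ℝ (Fin 3)) y ≤ 3) → (∀ p ∈ Y, ∀ q ∈ Y, p ≠ q → 1 ≤ dist p q) →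
  (0 : EuclideanSpace ℝ (Fin 3)) ∈ Y → (Y.filter fun q => dist (0 : EuclideanSpace ℝ (Fin 3)) q = 1).card ≤ 11 →
    sealedSummand₃ WordVersion.v2 (basalSystem (LinearIsometryEquiv.refl ℝ (EuclideanSpace ℝ (Fin 3)))) (basalSystem (ℝ ∙ EuclideanSpace.single (2 : Fin 3) (1 : ℝ)).reflection) Y
      (unionCoreStar Y 0 WordVersion.v2 (basalSystem (LinearIsometryEquiv.refl ℝ (EuclideanSpace ℝ (Fin 3))))
        (basalSystem (ℝ ∙ EuclideanSpace.single (2 : Fin 3) (1 : ℝ)).reflection)) 0 ≤ s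

/-- Monotonicity in the line. -/
theorem unionCoreSealedCapWin₃_mono {s s' : ℝ} (h : UnionCoreSealedCapWin₃ s) (hs : s ≤ s') : UnionCoreSealedCapWin₃ s' :=
  fun Y hW hY h0 hdeg => (h Y hW hY h0 hdeg).trans hs

/-- The floor-3 star certificate implies the sealed one. -/
theorem unionCoreSealedCapWin₃_of_win₃ {s : ℝ} (h : UnionCoreStarCapWin₃ s) : UnionCoreSealedCapWin₃ s :=
  fun Y hW hY h0 hdeg => (sealedSummand₃_le_payerSummand₃ _ _ _ _ _ _).trans (h Y hW hY h0 hdeg)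

open scoped Classical in
/-- **`P5Exhaustion → ThreePayer → UnionCoreSealedCapWin₃ s → Σ_A(Y, z) ≤ s` for EVERY frame and payer** (transport `z ↦ 0`, `L ↦ refl`; radius-`3` locality). -/
theorem localSummandA_le_of_threePayer_of_sealedWin₃ (hE1 : P5Exhaustion) (h3 : ThreePayer) {s : ℝ} (h : UnionCoreSealedCapWin₃ s)
    (L : EuclideanSpace ℝ (Fin 3) ≃ₗᵢ[ℝ] EuclideanSpace ℝ (Fin 3)) {Y : Finset (EuclideanSpace ℝ (Fin 3))} (hY : ∀ p ∈ Y, ∀ q ∈ Y, p ≠ q → 1 ≤ dist p q)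
    {z : EuclideanSpace ℝ (Fin 3)} (hz : z ∈ Y) (hdeg : (Y.filter fun q => dist z q = 1).card ≤ 11) :
    localSummandA WordVersion.v2 (basalSystem L) (basalSystem (((ℝ ∙ EuclideanSpace.single (2 : Fin 3) (1 : ℝ)).reflection).trans L)) Y z ≤ s := by
  set H : EuclideanSpace ℝ (Fin 3) ≃ₗᵢ[ℝ] EuclideanSpace ℝ (Fin 3) := (ℝ ∙ EuclideanSpace.single (2 : Fin 3) (1 : ℝ)).reflection with hH
  set X := Y.image fun y => L.symm y + -L.symm z with hXdef
  have hX : ∀ p ∈ X, ∀ q ∈ X, p ≠ q → 1 ≤ dist p q := separated_image_rigid hY L.symm _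
  have hYX : Y = X.image fun x => L x + z := by
    have e := image_rigid_symm Y L.symm (-L.symm z)
    simp only [LinearIsometryEquiv.symm_symm, map_neg, LinearIsometryEquiv.apply_symm_apply, neg_neg] at e
    rw [hXdef, e]
  have h0 : (0 : EuclideanSpace ℝ (Fin 3)) ∈ X := mem_image.2 ⟨z, hz, by simp⟩
  have hzz : z = L 0 + z := by simp
  have hdeg0 : (X.filter fun q => dist (0 : EuclideanSpace ℝ (Fin 3)) q = 1).card ≤ 11 := by
    rw [← degree_transport X L z 0, ← hYX, ← hzz]; exact hdeg
  have key := localSummandA_transport X L z WordVersion.v2 (LinearIsometryEquiv.refl ℝ (EuclideanSpace ℝ (Fin 3))) H basalHexagon basalHexagon 0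
  rw [← hYX, ← hzz, LinearIsometryEquiv.refl_trans] at key
  change localSummandA WordVersion.v2 ⟨L, basalHexagon⟩ ⟨H.trans L, basalHexagon⟩ Y z ≤ s
  rw [key]
  set X₀ := X.filter fun x => dist (0 : EuclideanSpace ℝ (Fin 3)) x ≤ 3 with hX₀def
  have hagree : ∀ x, dist (0 : EuclideanSpace ℝ (Fin 3)) x ≤ 3 → (x ∈ X ↔ x ∈ X₀) := fun x hx => by
    rw [hX₀def, mem_filter]; exact ⟨fun h => ⟨h, hx⟩, fun h => h.1⟩
  have h₁ : (basalSystem (LinearIsometryEquiv.refl ℝ (EuclideanSpace ℝ (Fin 3)))).RT ⊆ fccSlots := filter_subset _ _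
  have h₂ : (basalSystem H).RT ⊆ fccSlots := filter_subset _ _
  have hloc := localSummandA_congr_of_agree (v := WordVersion.v2) hagree h₁ h₂ (z := 0) (by simp)
  change localSummandA WordVersion.v2 (basalSystem (LinearIsometryEquiv.refl ℝ (EuclideanSpace ℝ (Fin 3)))) (basalSystem H) X 0 ≤ s
  rw [hloc]
  have hX₀ : ∀ p ∈ X₀, ∀ q ∈ X₀, p ≠ q → 1 ≤ dist p q := fun p hp q hq hne => hX p (mem_filter.1 hp).1 q (mem_filter.1 hq).1 hne
  have hW : ∀ y ∈ X₀, dist (0 : EuclideanSpace ℝ (Fin 3)) y ≤ 3 := fun y hy => (mem_filter.1 hy).2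
  have h00 : (0 : EuclideanSpace ℝ (Fin 3)) ∈ X₀ := mem_filter.2 ⟨h0, by simp⟩
  have hdeg00 : (X₀.filter fun q => dist (0 : EuclideanSpace ℝ (Fin 3)) q = 1).card ≤ 11 := by
    rw [← degree_congr_of_agree hagree (y := 0) (by simp)]; exact hdeg0
  exact (localSummandA_le_sealedSummand₃_unionCoreStar hE1 h3 hX₀ h₁ h₂ h00 hdeg00).trans (h X₀ hW hX₀ h00 hdeg00)

/-- **`P5Exhaustion → ThreePayer → UnionCoreSealedCapWin₃ s → SeamResidual s k₀`.** -/
theorem seamResidual_of_threePayer_of_sealedWin₃ (hE1 : P5Exhaustion) (h3 : ThreePayer) {s : ℝ} {k₀ : ℕ} (h : UnionCoreSealedCapWin₃ s) : SeamResidual s k₀ :=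
  fun L _ hY _ hz hdeg _ _ _ _ => Or.inr (localSummandA_le_of_threePayer_of_sealedWin₃ hE1 h3 h L hY hz hdeg)

/-- **`P5Exhaustion → ThreePayer → UnionCoreSealedCapWin₃ s → CoherentSeamSmall s k₀`.** -/
theorem coherentSeamSmall_of_threePayer_of_sealedWin₃ (hE1 : P5Exhaustion) (h3 : ThreePayer) {s : ℝ} {k₀ : ℕ} (h : UnionCoreSealedCapWin₃ s) :
    CoherentSeamSmall s k₀ :=
  fun L _ hY _ hz hdeg _ _ _ _ _ => Or.inr (localSummandA_le_of_threePayer_of_sealedWin₃ hE1 h3 h L hY hz hdeg)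

/-- **`P5Exhaustion → ThreePayer → UnionCoreSealedCapWin₃ s → IncoherentSeamSmall s k₀`.** -/
theorem incoherentSeamSmall_of_threePayer_of_sealedWin₃ (hE1 : P5Exhaustion) (h3 : ThreePayer) {s : ℝ} {k₀ : ℕ} (h : UnionCoreSealedCapWin₃ s) :
    IncoherentSeamSmall s k₀ :=
  fun L _ hY _ hz hdeg _ _ _ _ _ => Or.inr (localSummandA_le_of_threePayer_of_sealedWin₃ hE1 h3 h L hY hz hdeg)

/-- **The by-name closers' shape for lane F v8.3 (cf-p1 (cclxx))**: `stub_E1 : P5Exhaustion`, `stub_threePayer : ThreePayer` and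
`stub_unionCoreSealedCapWin₃ : UnionCoreSealedCapWin₃ (2√6)` close both T5b stubs at `k₀ = 3`. -/
theorem t5b_of_threePayer_of_sealedWin₃ (hE1 : P5Exhaustion) (h3 : ThreePayer) (h : UnionCoreSealedCapWin₃ (2 * Real.sqrt 6)) :
    CoherentSeamSmall (2 * Real.sqrt 6) 3 ∧ IncoherentSeamSmall (2 * Real.sqrt 6) 3 :=
  ⟨coherentSeamSmall_of_threePayer_of_sealedWin₃ hE1 h3 h, incoherentSeamSmall_of_threePayer_of_sealedWin₃ hE1 h3 h⟩

end TailResidue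

end Summit.Ventures.Crystal3D.Theorems

end
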